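import Mathlib.RingTheory.Nakayama
import Mathlib.RingTheory.LocalRing.MaximalIdeal.Basic
import Mathlib.RingTheory.LocalRing.ResidueField.Basic
import Literature.NumberTheory.GaussSums.PadicStationaryPhaseProofs
import Summits.ResolutionOfSingularities.ResolutionOfSingularities.Theorems.EquisingularLiftEquisingularLiftNatEquinodalJacobian
import HarnessLib

/-!
# [OURS · L1 W4.5(b) · EL♮(3) · nose residue, door ν4 «EQUINODAL PLANAR NOSE», brick (N9b)] NODE SECTIONS OF THE EQUINODAL LIFT ARE UNIQUE
# («no other singular point in the residue tube», NU4-SIZING §M (m4)) — over ANY local ring, by Nakayama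

Cell `res-hironaka`, rung L, slot W4.5(b); crux CHILD EL♮(3) = stmt-ResolutionOfSingularities-20148.  TEXT by res-L1-w45b-idea-3 g15 (custody seat, cannot
propose; scratch of record `Cruxes/EquisingularLiftNatThree/N9b_scratch_idea3_g15.lean` = `L/res-L1-w45b-idea-3/g15/N9b_scratch.lean` sha16 b561645145aca758,
farm rc 0, 0 sorries), FILED VERBATIM (namespace and imports house-styled, proofs untouched) by the WIDTH seat res-L1-w45b-nose-w1 g3 (brick (N9b) of its
OFFER l.≈83643, the companion of (D6-1) `Equinodal.exists_equinodal_lift` ✓ p670351).  `--supports stmt-ResolutionOfSingularities-20148 --as helper`, counted 0.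
OURS; nothing of [Hironaka2017]; AI-written, weaker than expert review; DEF-FREE, no `sorry`, standard axioms; EL♮(3) NOT proved; resolution in positive
characteristic NOT proved (dim 3 = Cossart–Piltant 2008/2009).

WHAT.  `node_section_unique`: `O` ANY local ring, `g : MvPolynomial (Fin 3) O`, `n n' : Fin 3 → O` in the same chart (`n' 2 = n 2`) with the same reduction,
`∂₀ g`, `∂₁ g` vanishing at both, and the Hessian minor `H₀₀H₁₁ − H₀₁²` a unit at `n` ⟹ `n' = n`.  Proof: `d = n' − n`, `I = (d 0, d 1) ≤ 𝔪`; the square-zero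
Taylor expansion in `O ⧸ I²` (`Literature.NumberTheory.GaussSums.DabrowskiFisher1997.eval_add_of_mul_eq_zero`, cited not re-proved) gives
`Hessian · (d 0, d 1) = 0` there, the unit determinant gives `d 0, d 1 ∈ I²`, so `I ≤ I • I` and Nakayama (`Submodule.eq_bot_of_le_smul_of_le_jacobson_bot`)
gives `I = ⊥`.  No completeness, no separatedness, no Noetherian hypothesis.  `node_section_unique'`: the chart form consuming the output shape of
`Equinodal.exists_equinodal_lift` (`n 2 = 1`, `g(n) = 0`, `∇g(n) = 0`, Hessian a unit): any `O`-point of `{∂₀g = ∂₁g = 0}` in the chart reducing to the same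
residue point IS the node section — i.e. the relative singular locus of the lifted nose over the residue tube of each marked node is the section (§M (m4),
crit-2 l.83581 / crit-3 l.83594 (4)).
-/

set_option linter.dupNamespace false

noncomputable section

namespace Summit.ResolutionOfSingularities.ResolutionOfSingularities.Cruxes.EquisingularLiftNat.Sections.Equinodal

open MvPolynomial IsLocalRing
open Literature.NumberTheory.GaussSums (DabrowskiFisher1997.eval_add_of_mul_eq_zero)

/-- Push `eval` through a ring hom: `φ (eval n P) = eval (φ ∘ n) (map φ P)`. [folklore] -/
theorem ringHom_eval {R S : Type*} [CommRing R] [CommRing S] (φ : R →+* S) {σ : Type*}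
    (n : σ → R) (P : MvPolynomial σ R) : φ (eval n P) = eval (φ ∘ n) (map φ P) := by
  rw [eval_map, ← eval₂_id, eval₂_comp_left, RingHom.comp_id]

/-- **NODE SECTIONS ARE UNIQUE (N9b core; text res-L1-w45b-idea-3 g15, scratch b561645145aca758, filed verbatim by res-L1-w45b-nose-w1 g3).** Over ANY local ring: a second zero `n'` of `(∂₀ g, ∂₁ g)` in the same chart (`n' 2 = n 2`)
and in the residue tube of `n`, where the Hessian minor of `g` at `n` is a unit, equals `n`.
[Nakayama; no completeness] -/
theorem node_section_unique {O : Type*} [CommRing O] [IsLocalRing O]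
    (g : MvPolynomial (Fin 3) O) (n n' : Fin 3 → O)
    (h2 : n' 2 = n 2) (hres : ∀ j, residue O (n' j) = residue O (n j))
    (hn : ∀ j : Fin 2, eval n (pderiv (Fin.castSucc j) g) = 0)
    (hn' : ∀ j : Fin 2, eval n' (pderiv (Fin.castSucc j) g) = 0)
    (hhess : IsUnit (eval n (pderiv 0 (pderiv 0 g)) * eval n (pderiv 1 (pderiv 1 g))
      - eval n (pderiv 0 (pderiv 1 g)) ^ 2)) :
    n' = n := by
  classical
  -- the difference and the ideal it generates
  set d : Fin 3 → O := n' - n with hd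
  have hd2 : d 2 = 0 := by simp [hd, h2]
  have hdm : ∀ j, d j ∈ maximalIdeal O := by
    intro j
    have h0 : residue O (n' j - n j) = 0 := by rw [map_sub, hres j, sub_self]
    simpa [hd] using (IsLocalRing.residue_eq_zero_iff _).mp h0
  set I : Ideal O := Ideal.span {d 0, d 1} with hI
  have hdI : ∀ j, d j ∈ I := by
    intro j
    fin_cases j
    · exact Ideal.subset_span (by simp)
    · exact Ideal.subset_span (by simp)
    · simp [hd2]
  have hIm : I ≤ maximalIdeal O := by
    rw [hI, Ideal.span_le]
    rintro a ha
    simp only [Set.mem_insert_iff, Set.mem_singleton_iff] at ha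
    rcases ha with rfl | rfl
    · exact hdm 0
    · exact hdm 1
  -- work modulo I²
  set π : O →+* O ⧸ (I * I) := Ideal.Quotient.mk (I * I) with hπ
  have hππ : ∀ j k, π (d j) * π (d k) = 0 := by
    intro j k
    rw [← map_mul, hπ, Ideal.Quotient.eq_zero_iff_mem]
    exact Ideal.mul_mem_mul (hdI j) (hdI k)
  have hn'eq : (π ∘ n') = (π ∘ n) + (π ∘ d) := by
    funext j; simp [hd]
  -- Taylor for ∂ᵢ g, i = 0, 1, in O ⧸ I²
  have key : ∀ i : Fin 2,
      ∑ j : Fin 3, π (eval n (pderiv j (pderiv (Fin.castSucc i) g))) * π (d j) = 0 := by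
    intro i
    have hT := DabrowskiFisher1997.eval_add_of_mul_eq_zero (map π (pderiv (Fin.castSucc i) g))
      (π ∘ n) (π ∘ d) hππ
    rw [← hn'eq, ← ringHom_eval, ← ringHom_eval, hn' i, hn i, map_zero, zero_add] at hT
    simp_rw [pderiv_map, ← ringHom_eval, Function.comp_apply] at hT
    exact hT.symm
  -- the two linear equations  H · (π d0, π d1) = 0
  have hsum : ∀ f : Fin 3 → O ⧸ (I * I), ∑ j : Fin 3, f j * π (d j) = f 0 * π (d 0) + f 1 * π (d 1) := by
    intro f
    rw [Fin.sum_univ_three, hd2, map_zero, mul_zero, add_zero]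
  have e0 := key 0
  have e1 := key 1
  rw [hsum] at e0 e1
  simp only [Fin.castSucc_zero, Fin.castSucc_one] at e0 e1
  -- names for the Hessian entries
  set a := eval n (pderiv 0 (pderiv 0 g)) with ha
  set b := eval n (pderiv 0 (pderiv 1 g)) with hb
  set c := eval n (pderiv 1 (pderiv 1 g)) with hc
  have hb' : eval n (pderiv 1 (pderiv 0 g)) = b := by rw [hb, pderiv_pderiv_comm]
  rw [hb'] at e0
  -- e0 : π a * π d0 + π b * π d1 = 0 ;  e1 : π b * π d0 + π c * π d1 = 0
  obtain ⟨u, hu⟩ := hhess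
  -- D := a c - b² ;  d0 · D = c·(e0) - b·(e1),  d1 · D = a·(e1) - b·(e0)
  have hD0 : π (d 0) * π (a * c - b ^ 2) = 0 := by
    have : π (d 0) * π (a * c - b ^ 2)
        = π c * (π a * π (d 0) + π b * π (d 1)) - π b * (π b * π (d 0) + π c * π (d 1)) := by
      simp only [map_mul, map_sub, map_pow]; ring
    rw [this, e0, e1]; ring
  have hD1 : π (d 1) * π (a * c - b ^ 2) = 0 := by
    have : π (d 1) * π (a * c - b ^ 2)
        = π a * (π b * π (d 0) + π c * π (d 1)) - π b * (π a * π (d 0) + π b * π (d 1)) := by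
      simp only [map_mul, map_sub, map_pow]; ring
    rw [this, e0, e1]; ring
  have hunit : IsUnit (π (a * c - b ^ 2)) := by rw [← hu]; exact (u.map π.toMonoidHom).isUnit
  have hd0 : π (d 0) = 0 := (IsUnit.mul_left_eq_zero hunit).mp hD0
  have hd1 : π (d 1) = 0 := (IsUnit.mul_left_eq_zero hunit).mp hD1
  -- hence I ≤ I² and Nakayama
  have hmemII : ∀ x, π x = 0 → x ∈ I * I := by
    intro x hx
    rwa [hπ, Ideal.Quotient.eq_zero_iff_mem] at hx
  have hII : I ≤ I • I := by
    show Ideal.span {d 0, d 1} ≤ I • I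
    rw [Ideal.span_le]
    rintro x hx
    simp only [Set.mem_insert_iff, Set.mem_singleton_iff] at hx
    have hx' : π x = 0 := by rcases hx with rfl | rfl <;> assumption
    exact hmemII x hx'
  have hfg : (I : Submodule O O).FG := by
    show (Ideal.span {d 0, d 1}).FG
    exact Submodule.fg_span (Set.toFinite _)
  have hjac : I ≤ (⊥ : Ideal O).jacobson :=
    hIm.trans (IsLocalRing.maximalIdeal_le_jacobson _)
  have hI0 : I = ⊥ := Submodule.eq_bot_of_le_smul_of_le_jacobson_bot I I hfg hII hjac
  -- conclude
  have hdz : ∀ j, d j = 0 := by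
    intro j
    have := hdI j
    rw [hI0] at this
    simpa using this
  funext j
  have := hdz j
  simp only [hd, Pi.sub_apply, sub_eq_zero] at this
  exact this

/-- **NODE SECTIONS ARE UNIQUE, chart form (N9b; text res-L1-w45b-idea-3 g15).** With the node system at `n` in the shape output by the tree theorem
`Equinodal.exists_equinodal_lift` (chart `n 2 = 1`, `g(n) = 0`, `∇g(n) = 0`, Hessian minor a unit), any
`O`-point `n'` of `{∂₀ g = ∂₁ g = 0}` in the same chart reducing to the same residue point IS `n`. -/
theorem node_section_unique' {O : Type*} [CommRing O] [IsLocalRing O]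
    (g : MvPolynomial (Fin 3) O) (n n' : Fin 3 → O)
    (hchart : n 2 = 1) (hchart' : n' 2 = 1) (hres : ∀ j, residue O (n' j) = residue O (n j))
    (hnode : eval n g = 0 ∧ ∀ j, eval n (pderiv j g) = 0)
    (hn' : eval n' (pderiv 0 g) = 0 ∧ eval n' (pderiv 1 g) = 0)
    (hhess : IsUnit (eval n (pderiv 0 (pderiv 0 g)) * eval n (pderiv 1 (pderiv 1 g))
      - eval n (pderiv 0 (pderiv 1 g)) ^ 2)) :
    n' = n := by
  refine node_section_unique g n n' (hchart'.trans hchart.symm) hres ?_ ?_ hhess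
  · intro j; exact hnode.2 _
  · intro j
    fin_cases j
    · simpa using hn'.1
    · simpa using hn'.2


end Summit.ResolutionOfSingularities.ResolutionOfSingularities.Cruxes.EquisingularLiftNat.Sections.Equinodal

end
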